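import Literature.MathematicalPhysics.QuantumFieldTheory.Balaban1983to89.Node00.Record12ResidualsSlots
import Literature.MathematicalPhysics.QuantumFieldTheory.Balaban1983to89.B16RLeafRecord11
import Literature.MathematicalPhysics.QuantumFieldTheory.Balaban1983to89.Node00.RStepProvisosIntOfRecord

/-!
# NODE 00 (YM-PLAN Track A) — STAGE 12, FILE 12c″: ROW P12 PROPER — WHEN IS THE POST-𝐑 SLOT OF A PRESENT SEQUENCE NOT THE ZERO DENSITY?
# The 𝐓-half (the χ-weighted mass of a 𝐓-image slot IS the graph integral of its labelled term), the 𝐑-half (at a fixed point of the selector the (0.3)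
# 𝐑-factor is `≥ 1` wherever the diagonal fibre integral is not zero), LIVE TERMS EXIST at every level up to the torus (mass conservation), and the located
# reach of 12b's `SlotsNondegenerate` BEYOND the torus

Cell `pub-ymgap`, NODE 00, K0′-components seat `pub-ymgap-node00-def-K0b` (g2), row P12 of the K0′ table (`Record12Inhabited` = the item whose body is
`∃ θ, θ.Provisos₁₂ ∧ (θ.ZtUnity ∧ θ.SlotsNondegenerate) ∧ θ.Admissible`), after director-ym LINE №114 (α): *«re-pin the selector of the K0′ witness to the
PRESENT sequences; prove `slotsNondegenerate_…` from K0b's present-slot non-vanishing»*, and alongside node00-def-K0a's live-retraction selector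
(`Record12LiveSelector`: a selector that is the identity on LIVE sequences and collapses every other one onto a live one — the shape print's `Z ↦ Z″` has).
[III] = [Balaban1988Convergent] (journal page = PDF page + 242), [IV] = [Balaban1989LargeFieldI].

THE QUESTION.  12b's `Stage12Params.SlotsNondegenerate θ` asks, for every run `p`, level `k` and sequence `s` in the range of the selector `θ.ppSel p g k`,
that the post-𝐑 slot of record `slot_k(s)` is not the zero density.  By def-R's (0.3) 𝐑-step on slots (`rstepOfSel_TexpA`)
`slot_{k+1}(s′)(V) = slotT_{k+1}(s′)(V) · Σ_{a : sel a = s′} ∫⌈_{Z′(a)} t_a ∕ ∫⌈_{Z′(a)} t_{s′}` with `t_a = χ_{k+1}(a)·slotT_{k+1}(a)`, and the 𝐓-image slot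
`slotT_{k+1}(s′)(V′) = h(V′)·∫ w(s′)(U,V′)·χ_k(s)(U)·slot_k(s)(U) κ_{V′}(dU)` ((†), `s = init s′`) is the disintegration-kernel transport of record, whose marginal
density `h` and kernel `κ` are Radon–Nikodym ∕ conditional-kernel VERSIONS (`Classical.choice`): pointwise values are reachable only through integrals.

WHAT THIS FILE PROVES (theorems only; every object BY NAME from def-T ∕ def-R ∕ n02-b ∕ b01; nothing restated).
* §1 THE 𝐓-HALF `integral_chi_mul_slotsTOfRecord_succ`: under def-T's displayed `TStepProvisos` at `k < K`,
  `∫dV′ χ_{k+1}(s′)·slotT_{k+1}(s′) = ∫dU [χ_k(s)·slot_k(s)](U) · [w(s′)(U,Ū)·χ_{k+1}(s′)(Ū)]` (FILE 1's `integral_transport_piece`, the one-step disintegration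
  `(dV′·h) ⊗ κ = law of (Ū, U)`); hence `exists_chi_ne_zero_and_slotsTOfRecord_succ_ne_zero`: a non-zero GRAPH INTEGRAL gives a configuration on the
  `χ_{k+1}(s′)`-support where the 𝐓-image slot is non-zero.
* §2 THE 𝐑-HALF AT A FIXED POINT, value-keyed and sign-free: `one_le_sum_rratio_of_sel_self` (the 𝐑-factor is `≥ 1` where `∫⌈_{Z′(s′)} t_{s′} ≠ 0`: the diagonal
  ratio is `1`, every other one a quotient of non-negative fibre integrals), `rstepOfSel_TexpA_eq_zero_iff_of_sel_self`, `abs_TexpA_le_abs_rstepOfSel_TexpA_of_sel_self`;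
  at the record `rstepSlotOfRecord_apply_eq_zero_iff_of_sel_self`, `rstepSlotOfRecord_apply_ne_zero_of_sel_self` (support-form proviso at the point).
  §2b `exists_ne_zero_and_fibreIntegral_ne_zero`: Fubini over a fibre — a measurable `0 ≤ t ≤ C` with `∫ t ≠ 0` is, at SOME configuration, non-zero together
  with its own fibre integral (b01's `IndepOf` ∕ `lmarginal_mul_of_indepOf` ∕ `lintegral_lmarginal_eq`).
* §3 THE JUNCTION at a Stage-9 tuple under `Provisos₁₀`, `k < K`: `slotsOfRecord_succ_apply_ne_zero_of_sel_self` (point form),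
  `slotsOfRecord_succ_ne_zero_of_sel_self_of_integral_ne_zero` (a fixed point of the selector with non-zero graph integral has a non-zero post-𝐑 slot).
* §4 LIVE TERMS EXIST: `sum_integral_graph_eq_integral_densOfRecord₁₀` (`Σ_{s′} graph(s′) = ∫𝐓ρ_k = ∫ρ_k`, the tower's `isRT_Trho` face at `f ≡ 1`),
  `integral_densOfRecord₁₀_pos` (`∫ρ_k = ∫ρ₀ > 0`, `k ≤ K`), `exists_integral_graph_ne_zero`; and **`exists_live_slotsTOfRecord_succ`** (+ `_rterm` form): at EVERY
  level `k+1 ≤ K` of EVERY run there are `s`, `V` with `slotT_{k+1}(s)(V) ≠ 0 ∧ ∫⌈_{Z′(s)} χ_{k+1}(s)·slotT_{k+1}(s) (V) ≠ 0` — the liveness a live-retraction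
  selector keys on — from `Provisos₁₀` ALONE.  So ROW P12 IS A THEOREM UP TO THE TORUS modulo the displayed provisos every K0′ witness carries anyway.
* §5 `slotsOfRecord_ne_zero_of_mem_range_of_le`: at a Stage-12 parameter whose selector fixes its range and selects live graph terms, 12b's predicate READ UP TO
  THE TORUS (`k ≤ p.K`) holds.
* §6 LOCATED (for the record's pen, not a defect of any landed theorem): 12b's `SlotsNondegenerate` is UNGUARDED IN THE LEVEL — `nonempty_seqOfRecord` (the
  all-`∅` chain inhabits every level, also `k > K`) and `exists_slotsOfRecord_ne_zero_of_slotsNondegenerate` (the predicate demands a non-zero post-𝐑 slot at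
  EVERY level of EVERY run).  Beyond the torus the 𝐓-step transports along `avOfRecord F N K k` with no `HaarAC` in the tree (`avOfRecord_haarAC` needs
  `k < K`; the lattices `Site (F.P K) k` stabilise for `k ≥ K`) and `Provisos₁₀` displays nothing, so no kernel fact reaches those slots: the unguarded predicate is
  neither provable nor refutable there in practice.  A `k ≤ p.K` guard in the def (as `Provisos₁₂.bg` has `n ≤ p.K`) makes §4–§5 its full content.

(v1.1) §7 THE SAME IN THE INTEGRABLE (INT) CURRENCY of def-R's FILE 17 (`Node00.RStepProvisosIntOfRecord`: `RepData.ProvisosInt`, `Stage9Params.RStepInt` —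
pieces integrable, `≥ 0` a.e., support clause a.e.; the form in which row P6 is a theorem at the live-selector witness): `exists_ne_zero_and_fibreIntegral_ne_zero_of_integrable`
(the Fubini lemma from def-R's `ae_eq_zero_of_self_or_fibreIntegral_eq_zero`), mass conservation `integral_densOfRecord₁₀_succ_eq_of_int` ∕ `…_eq_zero_of_int` ∕
`…_pos_of_int` from the displayed `TStepProvisos` at the levels `≤ k` and `RStepInt` (def-R's (0.4) in INT form + def-T's `isRT_trhoOfRecord9` at `f ≡ 1`), and
**`exists_live_slotsTOfRecord_succ_of_int`**: the live sequence at every level `k+1 ≤ K` from `(∀ j < K, TStepProvisos … j)` and `θ.RStepInt` alone — so row P12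
survives a re-keying of the record's `rstep` proviso to the INT form by name (`Provisos₁₀` gives both: `Provisos₁₀.tstep`, `rstepInt_of_provisos₁₀`).

(v1.2, filed by `pub-ymgap-node00-def-T` g6 under director-ym LINE №120's ONE-OFF WRITER EXCEPTION — K0b's seat closed; build-order fix ahead of 12b v2.3)
§6 RE-POINTED TO THE GUARD: director LINE №118 rules that 12b's `Stage12Params.SlotsNondegenerate` be GUARDED by the level `k ≤ p.K` (Record12 v2.3, the
range in which the tuple displays the slot's construction), which deletes exactly the «beyond the torus» region §6 exhibited.  The one theorem that applied
the predicate's body positionally at every level, `exists_slotsOfRecord_ne_zero_of_slotsNondegenerate`, now carries `(hk : k ≤ p.K)` and a proof written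
two-way (`apply h; all_goals first | exact hk | exact ⟨s₀, rfl⟩`) so that this file elaborates BEFORE and AFTER v2.3 lands; nothing else is touched.

HONEST SCOPE.  Finite sums, Bochner ∕ Lebesgue bookkeeping on the tree's disintegration and fibre-integral faces, mass conservation of the tower of record;
the analytic inputs are the DISPLAYED provisos (`TStepProvisos`, `Provisos₁₀`: integrable pieces, measurable bounded weights, support-form (0.3) provisos),
never asserted.  NOTHING of Bałaban's estimates is claimed; `SlotsNondegenerate` is not discharged for any θ here (K0a's live selector consumes §4); counts
unmoved (typed 28∕28 · discharged 5∕28); one finite four-torus programme at fixed `ε = L^{−K}` — NOT the continuum limit, NOT OS, NOT a mass gap, NOT Clay.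
No `sorry`, no `axiom`, no `def`, no `instance`, no `notation`.
-/

noncomputable section

open MeasureTheory ProbabilityTheory
open scoped BigOperators Matrix.Norms.L2Operator

namespace Literature.MathematicalPhysics.QuantumFieldTheory.Balaban1983to89.Node00

open T4AveragingDisintegration T4Continuum T4FiniteEpsInhabited B14.Eq218Concrete
open Tk

/-! ## §1  The 𝐓-half: the χ-weighted integral of a pre-𝐑 slot one level up IS the graph integral of its labelled term -/

section THalf

variable (F : T4Family) (N : ℕ) [NeZero N] (ν : Stage7Numerics) (τ : TowerNumerics)

/-- **THE INTEGRATED IDENTITY ONE LEVEL UP, PER SEQUENCE**: under the displayed step provisos at `k < K`, for every new sequence `s′` (old sequence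
`s = init s′`), `∫dV′ χ_{k+1}(s′)(V′)·slotT_{k+1}(s′)(V′) = ∫dU [χ_k(s)(U)·slot_k(s)(U)] · [w(s′)(U, Ū)·χ_{k+1}(s′)(Ū)]` — the χ-weighted total mass of the
𝐓-image slot of `s′` is the mass of the old term of `s` weighted by the label weight of `s′` ON THE GRAPH `V′ = Ū` (FILE 1's `integral_transport_piece`:
the one-step disintegration `(dV′·h) ⊗ κ = law of (Ū, U)`).  Pointwise values of the (†) transport are versions; this identity is how they are reached.
[cite: Balaban1988Convergent, (3.1) p.264, (3.24)–(3.25) p.270, (2.18) p.257] -/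
theorem integral_chi_mul_slotsTOfRecord_succ (E : B12.RunParams → ℝ) (w : StepWeightsOfRecord F N ν τ.M) (ppSel : PpSelOfRecord F ν τ.M)
    (p : B12.RunParams) (g : ℕ → ℝ) (k : ℕ) (hk : k < p.K) (h : TStepProvisos F N ν τ E w ppSel p g k)
    (s' : SeqOfRecord F ν τ.M g p.K (k + 1)) :
    ∫ V', chiSeqOfRecord F N ν τ.M g p.K (k + 1) s' V' * slotsTOfRecord F N ν τ E w ppSel p g (k + 1) s' V'
        ∂(fieldMeasure (F.P p.K) (k + 1) (SU N))
      = ∫ U, (chiSeqOfRecord F N ν τ.M g p.K k s'.init U * slotsOfRecord F N ν τ E w ppSel p g k s'.init U) *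
          (w p g k s' U ((avOfRecord F N p.K k).avg U) * chiSeqOfRecord F N ν τ.M g p.K (k + 1) s' ((avOfRecord F N p.K k).avg U))
        ∂(fieldMeasure (F.P p.K) k (SU N)) := by
  set avg := (avOfRecord F N p.K k).avg with havg_def
  have havg : Measurable avg := avOfRecord_measurable F N p.K k
  have hac : HaarAC avg := avOfRecord_haarAC F N p.K k hk
  have hb : Measurable (fun z : GaugeField (F.P p.K) (k + 1) (SU N) × GaugeField (F.P p.K) k (SU N) =>
      w p g k s' z.2 z.1 * chiSeqOfRecord F N ν τ.M g p.K (k + 1) s' z.1) :=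
    (h.measW s').mul ((h.measChi s').comp measurable_fst)
  have hbC : ∀ z : GaugeField (F.P p.K) (k + 1) (SU N) × GaugeField (F.P p.K) k (SU N),
      ‖w p g k s' z.2 z.1 * chiSeqOfRecord F N ν τ.M g p.K (k + 1) s' z.1‖ ≤ 1 := by
    intro z
    rw [Real.norm_eq_abs, abs_mul]
    calc |w p g k s' z.2 z.1| * |chiSeqOfRecord F N ν τ.M g p.K (k + 1) s' z.1| ≤ 1 * 1 :=
          mul_le_mul (h.absW_le _ _ _) (abs_chiSeqOfRecord_le_one F N ν τ.M g p.K (k + 1) s' z.1) (abs_nonneg _) zero_le_one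
      _ = 1 := by ring
  have key := integral_transport_piece havg hac (h.intPiece s'.init) hb hbC
  rw [← key]
  refine integral_congr_ae (ae_of_all _ fun V => ?_)
  dsimp only
  have : ∫ U, (chiSeqOfRecord F N ν τ.M g p.K k s'.init U * slotsOfRecord F N ν τ E w ppSel p g k s'.init U) *
        (w p g k s' U V * chiSeqOfRecord F N ν τ.M g p.K (k + 1) s' V) ∂(avgKernel avg V)
      = (∫ U, w p g k s' U V * (chiSeqOfRecord F N ν τ.M g p.K k s'.init U * slotsOfRecord F N ν τ E w ppSel p g k s'.init U)
          ∂(avgKernel avg V)) * chiSeqOfRecord F N ν τ.M g p.K (k + 1) s' V := by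
    rw [← integral_mul_const]
    refine integral_congr_ae (ae_of_all _ fun U => ?_)
    ring
  rw [this]
  show chiSeqOfRecord F N ν τ.M g p.K (k + 1) s' V * slotsTOfRecord F N ν τ E w ppSel p g (k + 1) s' V = _
  rw [slotsTOfRecord_succ, tstepOfRecord, texpASucc_apply]
  ring

/-- **CRITERION FOR A NON-VANISHING 𝐓-IMAGE SLOT ON ITS OWN χ-SUPPORT**: if the graph integral of the labelled term of `s′` is not zero, then at SOME
coarse configuration `V′` both `χ_{k+1}(s′)(V′) ≠ 0` and `slotT_{k+1}(s′)(V′) ≠ 0`. [cite: Balaban1988Convergent, (3.1) p.264, (3.25) p.270] -/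
theorem exists_chi_ne_zero_and_slotsTOfRecord_succ_ne_zero (E : B12.RunParams → ℝ) (w : StepWeightsOfRecord F N ν τ.M)
    (ppSel : PpSelOfRecord F ν τ.M) (p : B12.RunParams) (g : ℕ → ℝ) (k : ℕ) (hk : k < p.K) (h : TStepProvisos F N ν τ E w ppSel p g k)
    (s' : SeqOfRecord F ν τ.M g p.K (k + 1))
    (hne : ∫ U, (chiSeqOfRecord F N ν τ.M g p.K k s'.init U * slotsOfRecord F N ν τ E w ppSel p g k s'.init U) *
          (w p g k s' U ((avOfRecord F N p.K k).avg U) * chiSeqOfRecord F N ν τ.M g p.K (k + 1) s' ((avOfRecord F N p.K k).avg U))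
        ∂(fieldMeasure (F.P p.K) k (SU N)) ≠ 0) :
    ∃ V' : GaugeField (F.P p.K) (k + 1) (SU N),
      chiSeqOfRecord F N ν τ.M g p.K (k + 1) s' V' ≠ 0 ∧ slotsTOfRecord F N ν τ E w ppSel p g (k + 1) s' V' ≠ 0 := by
  by_contra hnone
  push Not at hnone
  apply hne
  rw [← integral_chi_mul_slotsTOfRecord_succ F N ν τ E w ppSel p g k hk h s']
  refine (integral_congr_ae (ae_of_all _ fun V' => ?_)).trans (integral_zero _ _)
  by_cases hc : chiSeqOfRecord F N ν τ.M g p.K (k + 1) s' V' = 0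
  · simp [hc]
  · simp [hnone V' hc]

end THalf

/-! ## §2  The 𝐑-half at a FIXED POINT of the selector, value-keyed: where the diagonal fibre integral is not zero the (0.3) 𝐑-factor is `≥ 1`,
so the post-𝐑 slot vanishes exactly where the pre-𝐑 slot does (no sign hypothesis) -/

section RHalf

variable {P : Params} {G : Type*} [GaugeGroup G] [MeasurableSpace G] [HaarData G] {j : ℕ}

open Classical in
/-- **ON A FIXED POINT OF THE SELECTOR THE 𝐑-FACTOR IS `≥ 1` WHEREVER THE DIAGONAL FIBRE INTEGRAL IS NOT ZERO**: with `sel a′ = a′` the fibre of `a′`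
contains `a′` itself, whose ratio is `∫⌈_{Z′(a′)} t_{a′} ∕ ∫⌈_{Z′(a′)} t_{a′} = 1`; every other ratio is a quotient of two non-negative fibre integrals (b01's
`fibreIntegral` is the `toReal` of a lower integral of `ofReal ∘ t`, non-negative WHATEVER the sign of `t`). [cite: Balaban1989LargeFieldI, (0.3) p.176] -/
theorem one_le_sum_rratio_of_sel_self {hP : DecidableEq (PBond P j)} (r : Step.Repr218 P G j) (sel : r.Adm → r.Adm)
    (fib : r.Adm → Finset (PBond P j)) (a' : r.Adm) (hfix : sel a' = a') (V : GaugeField P j G)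
    (hden : B15.BasicStep.fibreIntegral (fib a') (rterm r a') V ≠ 0) :
    1 ≤ ∑ a ∈ Finset.univ.filter (fun a => sel a = a'), rratio r fib a a' V := by
  have hmem : a' ∈ Finset.univ.filter (fun a => sel a = a') := by simp [hfix]
  rw [← Finset.add_sum_erase _ _ hmem]
  have h1 : rratio r fib a' a' V = 1 := by rw [rratio, div_self hden]
  rw [h1]
  have hrest : 0 ≤ ∑ x ∈ (Finset.univ.filter (fun a => sel a = a')).erase a', rratio r fib x a' V :=
    Finset.sum_nonneg fun x _ =>
      div_nonneg (B16RLeafRecord11.fibreIntegral_nonneg' _ _ V) (B16RLeafRecord11.fibreIntegral_nonneg' _ _ V)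
  linarith

open Classical in
/-- **THE POST-𝐑 SLOT VANISHES EXACTLY WHERE THE PRE-𝐑 SLOT DOES, at a fixed point of the selector where the diagonal fibre integral is not zero**
(`(𝐓e^A)′(a′)(V) = (𝐓e^A)(a′)(V) · (𝐑-factor ≥ 1)`).  No sign hypothesis on the slot. [cite: Balaban1989LargeFieldI, (0.3) p.176] -/
theorem rstepOfSel_TexpA_eq_zero_iff_of_sel_self {hP : DecidableEq (PBond P j)} (r : Step.Repr218 P G j) (sel : r.Adm → r.Adm)
    (fib : r.Adm → Finset (PBond P j)) (a' : r.Adm) (hfix : sel a' = a') (V : GaugeField P j G)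
    (hden : B15.BasicStep.fibreIntegral (fib a') (rterm r a') V ≠ 0) :
    (rstepOfSel r sel fib).TexpA a' V = 0 ↔ r.TexpA a' V = 0 := by
  rw [rstepOfSel_TexpA]
  have hS : (0 : ℝ) < ∑ a ∈ Finset.univ.filter (fun a => sel a = a'), rratio r fib a a' V :=
    lt_of_lt_of_le one_pos (one_le_sum_rratio_of_sel_self r sel fib a' hfix V hden)
  refine ⟨fun h0 => ?_, fun h0 => by rw [h0, zero_mul]⟩
  rcases mul_eq_zero.1 h0 with h | h
  · exact h
  · exact absurd h hS.ne'

open Classical in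
/-- **… AND DOMINATES IT IN ABSOLUTE VALUE**: `|(𝐓e^A)(a′)(V)| ≤ |(𝐓e^A)′(a′)(V)|` at a fixed point with non-zero diagonal fibre integral.
[cite: Balaban1989LargeFieldI, (0.3) p.176] -/
theorem abs_TexpA_le_abs_rstepOfSel_TexpA_of_sel_self {hP : DecidableEq (PBond P j)} (r : Step.Repr218 P G j) (sel : r.Adm → r.Adm)
    (fib : r.Adm → Finset (PBond P j)) (a' : r.Adm) (hfix : sel a' = a') (V : GaugeField P j G)
    (hden : B15.BasicStep.fibreIntegral (fib a') (rterm r a') V ≠ 0) :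
    |r.TexpA a' V| ≤ |(rstepOfSel r sel fib).TexpA a' V| := by
  rw [rstepOfSel_TexpA, abs_mul]
  refine le_mul_of_one_le_right (abs_nonneg _) ?_
  rw [abs_of_nonneg (le_trans zero_le_one (one_le_sum_rratio_of_sel_self r sel fib a' hfix V hden))]
  exact one_le_sum_rratio_of_sel_self r sel fib a' hfix V hden

end RHalf

section RHalfAtRecord

variable {F : T4Family} {N : ℕ} [NeZero N] (ν : Stage7Numerics) (τ : TowerNumerics)

/-- **`R` OF RECORD AS A SLOT OPERATION, AT A FIXED POINT `s′` OF `ppSel p g k`**: where `∫⌈_{Z′(s′)} χ_k(s′)·f(s′) (V) ≠ 0`, the 𝐑-stepped slot vanishes at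
`(s′, V)` iff the slot `f s′` does — for an ARBITRARY slot family `f` (no sign, no proviso). [cite: Balaban1989LargeFieldI, (0.3) p.176] -/
theorem rstepSlotOfRecord_apply_eq_zero_iff_of_sel_self (ppSel : PpSelOfRecord F ν τ.M) (p : B12.RunParams) (g : ℕ → ℝ) (k : ℕ)
    (f : TexpASlot F N ν τ.M p g k) (s' : SeqOfRecord F ν τ.M g p.K k) (hfix : ppSel p g k s' = s') (V : GaugeField (F.P p.K) k (SU N))
    (hden : B15.BasicStep.fibreIntegral (fibOfSeq F ν τ p g k s')
        (fun U => chiSeqOfRecord F N ν τ.M g p.K k s' U * f s' U) V ≠ 0) :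
    rstepSlotOfRecord F N ν τ ppSel p g k f s' V = 0 ↔ f s' V = 0 := by
  unfold rstepSlotOfRecord rstepSlot
  refine rstepOfSel_TexpA_eq_zero_iff_of_sel_self (sliceOfRecord F N ν τ.M p g k f) (ppSel p g k) (fibOfSeq F ν τ p g k) s' hfix V ?_
  intro hFI
  apply hden
  convert hFI using 2
  · rfl

/-- **UNDER THE SUPPORT-FORM PROVISO AT `(s′, V)` the post-𝐑 slot of a PRESENT sequence (a fixed point of the selector) IS NON-ZERO WHEREVER its pre-𝐑
slot is non-zero on the `χ_k(s′)`-support** (p. 176: «the densities are positive … hence the denominators are positive», read on the support: where the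
diagonal fibre integral vanishes so does the piece — so a non-vanishing piece has a non-zero denominator). [cite: Balaban1989LargeFieldI, (0.3) p.176] -/
theorem rstepSlotOfRecord_apply_ne_zero_of_sel_self (ppSel : PpSelOfRecord F ν τ.M) (p : B12.RunParams) (g : ℕ → ℝ) (k : ℕ)
    (f : TexpASlot F N ν τ.M p g k) (s' : SeqOfRecord F ν τ.M g p.K k) (hfix : ppSel p g k s' = s') (V : GaugeField (F.P p.K) k (SU N))
    (hsupp : B15.BasicStep.fibreIntegral (fibOfSeq F ν τ p g k s')
        (fun U => chiSeqOfRecord F N ν τ.M g p.K k s' U * f s' U) V = 0 →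
      chiSeqOfRecord F N ν τ.M g p.K k s' V * f s' V = 0)
    (hχ : chiSeqOfRecord F N ν τ.M g p.K k s' V ≠ 0) (hf : f s' V ≠ 0) :
    rstepSlotOfRecord F N ν τ ppSel p g k f s' V ≠ 0 := by
  have hden : B15.BasicStep.fibreIntegral (fibOfSeq F ν τ p g k s')
      (fun U => chiSeqOfRecord F N ν τ.M g p.K k s' U * f s' U) V ≠ 0 :=
    fun h0 => mul_ne_zero hχ hf (hsupp h0)
  rw [Ne, rstepSlotOfRecord_apply_eq_zero_iff_of_sel_self ν τ ppSel p g k f s' hfix V hden]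
  exact hf

end RHalfAtRecord

/-! ## §2b  Fubini over a fibre: a non-null non-negative bounded density is non-zero SOMEWHERE its own fibre integral is non-zero -/

section FibreFubini

open scoped ENNReal

variable {P : Params} {G : Type*} [GaugeGroup G] [MeasurableSpace G] [HaarData G] {j : ℕ}

open B15.BasicStep in
/-- **A NON-NULL TERM IS LIVE SOMEWHERE**: for a measurable density `0 ≤ t ≤ C` on the gauge fields of one lattice with `∫ t dV ≠ 0` and any finite set
`Z′` of bond variables, there is a configuration `V` with BOTH `t(V) ≠ 0` AND `∫dV⌈_{Z′} t (V) ≠ 0` (b01's `fibreIntegral`).  Proof: the set `B` where the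
fibre integral vanishes is a union of fibres (`IndepOf`), and `t` vanishes a.e. on it (`∫_B t = ∫ 1_B·∫⌈t = 0`); if `t` vanished off `B` too, `t` would be
null. (p. 176: «the densities are positive, and the integration domains … nonempty, hence the denominators are positive» — here in the measure-theoretic
form the objects of record allow.) [cite: Balaban1989LargeFieldI, (0.3)–(0.4) p.176] -/
theorem exists_ne_zero_and_fibreIntegral_ne_zero {hD : DecidableEq (PBond P j)} (s : Finset (PBond P j)) {t : Density P j G}
    (hm : Measurable t) (h0 : ∀ V, 0 ≤ t V) {C : ℝ} (hC : ∀ V, t V ≤ C)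
    (hint : ∫ V, t V ∂(fieldMeasure P j G) ≠ 0) :
    ∃ V : GaugeField P j G, t V ≠ 0 ∧ fibreIntegral s t V ≠ 0 := by
  by_contra hnone
  push Not at hnone
  set μH : PBond P j → Measure G := fun _ => (HaarData.haar : Measure G) with hμH
  set f : GaugeField P j G → ℝ≥0∞ := fun U => ENNReal.ofReal (t U) with hfdef
  have hf : Measurable f := ENNReal.measurable_ofReal.comp hm
  set Φ : GaugeField P j G → ℝ≥0∞ := ∫⋯∫⁻_s, f ∂μH with hΦ
  have hΦm : Measurable Φ := hf.lmarginal μH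
  have hΦtop : ∀ V, Φ V ≠ ∞ := fun V =>
    ne_top_of_le_ne_top ENNReal.ofReal_ne_top (lmarginal_ofReal_le s hC V)
  -- wherever the fibre integral is not zero, `t` vanishes (the contradiction hypothesis, read in `ℝ≥0∞`)
  have hkey : ∀ V, Φ V ≠ 0 → t V = 0 := by
    intro V hV
    by_contra htV
    have h2 : (Φ V).toReal = 0 := hnone V htV
    rcases (ENNReal.toReal_eq_zero_iff _).1 h2 with h | h
    · exact hV h
    · exact hΦtop V h
  set ind : GaugeField P j G → ℝ≥0∞ := fun V => if Φ V = 0 then 1 else 0 with hind_def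
  have hind : IndepOf s ind := by
    intro x y
    simp only [hind_def, hΦ, indepOf_lmarginal μH s f x y]
  have hmeasInd : Measurable ind :=
    Measurable.ite (hΦm (measurableSet_singleton 0)) measurable_const measurable_const
  have hfeq : f = ind * f := by
    funext V
    simp only [Pi.mul_apply, hind_def]
    split_ifs with h
    · rw [one_mul]
    · rw [zero_mul, hfdef]
      simp only [hkey V h, ENNReal.ofReal_zero]
  have hlin : ∫⁻ V, f V ∂(fieldMeasure P j G) = 0 := by
    rw [fieldMeasure_eq_pi]
    calc ∫⁻ V, f V ∂Measure.pi μH = ∫⁻ V, (ind * f) V ∂Measure.pi μH := by rw [← hfeq]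
      _ = ∫⁻ V, (∫⋯∫⁻_s, ind * f ∂μH) V ∂Measure.pi μH := (lintegral_lmarginal_eq μH s (hmeasInd.mul hf)).symm
      _ = ∫⁻ V, (ind * Φ) V ∂Measure.pi μH := by
          refine lintegral_congr fun V => ?_
          have hmul := lmarginal_mul_of_indepOf (μ := μH) s hind hf
          exact congrFun hmul V
      _ = ∫⁻ _, 0 ∂Measure.pi μH := by
          refine lintegral_congr fun V => ?_
          simp only [Pi.mul_apply, hind_def]
          split_ifs with h
          · rw [h, mul_zero]
          · rw [zero_mul]
      _ = 0 := lintegral_zero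
  have hae : f =ᵐ[fieldMeasure P j G] 0 := (lintegral_eq_zero_iff hf).1 hlin
  have htae : t =ᵐ[fieldMeasure P j G] 0 :=
    hae.mono fun V hV => le_antisymm (ENNReal.ofReal_eq_zero.1 hV) (h0 V)
  exact hint (integral_eq_zero_of_ae htae)

end FibreFubini

/-! ## §3  The junction at a Stage-9 tuple `θ′` under its displayed provisos: a fixed point of the level-`(k+1)` selector whose labelled term has non-zero
graph integral carries a NON-ZERO post-𝐑 slot (`k < K`) -/

section AtStage9

variable (F : T4Family) (N : ℕ) [NeZero N] (θ : Stage9Params F N) (p : B12.RunParams)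

/-- **POINT FORM**: under `Provisos₁₀` (support-form (0.3) provisos at level `k+1 ≤ K`), at a fixed point `s′` of `θ.ppSel p g (k+1)` and a configuration `V`
on the `χ_{k+1}(s′)`-support where the pre-𝐑 slot `slotT_{k+1}(s′)(V) ≠ 0`, the post-𝐑 slot `slot_{k+1}(s′)(V) ≠ 0`.
[cite: Balaban1989LargeFieldI, (0.3) p.176; Balaban1988Convergent, (2.18) p.257, (3.24)–(3.25) p.270] -/
theorem slotsOfRecord_succ_apply_ne_zero_of_sel_self (hP : θ.Provisos₁₀) (k : ℕ) (hk : k < p.K)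
    (s' : SeqOfRecord F θ.ν θ.τ9.M (gOfRecord₁₀ F N θ p) p.K (k + 1)) (hfix : θ.ppSel p (gOfRecord₁₀ F N θ p) (k + 1) s' = s')
    (V : GaugeField (F.P p.K) (k + 1) (SU N)) (hχ : chiSeqOfRecord F N θ.ν θ.τ9.M (gOfRecord₁₀ F N θ p) p.K (k + 1) s' V ≠ 0)
    (hT : slotsTOfRecord F N θ.ν θ.τ9 (EOfRecord₁₀ F N θ) (wOfRecord₉ F N θ) θ.ppSel p (gOfRecord₁₀ F N θ p) (k + 1) s' V ≠ 0) :
    slotsOfRecord F N θ.ν θ.τ9 (EOfRecord₁₀ F N θ) (wOfRecord₉ F N θ) θ.ppSel p (gOfRecord₁₀ F N θ p) (k + 1) s' V ≠ 0 := by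
  rw [slotsOfRecord_succ]
  have HP := hP.rstep p k hk
  have Hs := HP.2.2.2 s' V
  change B15.BasicStep.fibreIntegral (fibOfSeq F θ.ν θ.τ9 p (gOfRecord₁₀ F N θ p) (k + 1) s')
      (rterm (repr218OfRecord F N θ.ν θ.τ9.M (slotsTOfRecord F N θ.ν θ.τ9 (EOfRecord₁₀ F N θ)
        (wOfRecord₉ F N θ) θ.ppSel) p (gOfRecord₁₀ F N θ p) (k + 1))
        (θ.ppSel p (gOfRecord₁₀ F N θ p) (k + 1) s')) V = 0 →
      rterm (repr218OfRecord F N θ.ν θ.τ9.M (slotsTOfRecord F N θ.ν θ.τ9 (EOfRecord₁₀ F N θ)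
        (wOfRecord₉ F N θ) θ.ppSel) p (gOfRecord₁₀ F N θ p) (k + 1)) s' V = 0 at Hs
  rw [hfix] at Hs
  exact rstepSlotOfRecord_apply_ne_zero_of_sel_self θ.ν θ.τ9 θ.ppSel p _ (k + 1) _ s' hfix V Hs hχ hT

/-- **★ ROW P12, THE JUNCTION**: under `Provisos₁₀` at the Stage-9 tuple `θ′`, at a level `k+1 ≤ K`, a FIXED POINT `s′` of the selector `θ′.ppSel p g (k+1)` whose
labelled term has NON-ZERO GRAPH INTEGRAL `∫dU χ_k(s)(U)·slot_k(s)(U)·w(s′)(U,Ū)·χ_{k+1}(s′)(Ū) ≠ 0` (`s = init s′`) carries a post-𝐑 slot of record that is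
NOT the zero density: §1 gives a configuration on the `χ_{k+1}(s′)`-support where the 𝐓-image slot is non-zero, §2 (with the support-form proviso
`Provisos₁₀.rstep`) transfers it through def-R's (0.3) 𝐑-step. [cite: Balaban1988Convergent, (3.1) p.264, (3.24)–(3.25) p.270, (3.22) p.269; Balaban1989LargeFieldI, (0.3) p.176] -/
theorem slotsOfRecord_succ_ne_zero_of_sel_self_of_integral_ne_zero (hP : θ.Provisos₁₀) (k : ℕ) (hk : k < p.K)
    (s' : SeqOfRecord F θ.ν θ.τ9.M (gOfRecord₁₀ F N θ p) p.K (k + 1)) (hfix : θ.ppSel p (gOfRecord₁₀ F N θ p) (k + 1) s' = s')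
    (hne : ∫ U, (chiSeqOfRecord F N θ.ν θ.τ9.M (gOfRecord₁₀ F N θ p) p.K k s'.init U *
          slotsOfRecord F N θ.ν θ.τ9 (EOfRecord₁₀ F N θ) (wOfRecord₉ F N θ) θ.ppSel p (gOfRecord₁₀ F N θ p) k s'.init U) *
        (wOfRecord₉ F N θ p (gOfRecord₁₀ F N θ p) k s' U ((avOfRecord F N p.K k).avg U) *
          chiSeqOfRecord F N θ.ν θ.τ9.M (gOfRecord₁₀ F N θ p) p.K (k + 1) s' ((avOfRecord F N p.K k).avg U))
        ∂(fieldMeasure (F.P p.K) k (SU N)) ≠ 0) :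
    slotsOfRecord F N θ.ν θ.τ9 (EOfRecord₁₀ F N θ) (wOfRecord₉ F N θ) θ.ppSel p (gOfRecord₁₀ F N θ p) (k + 1) s' ≠ 0 := by
  obtain ⟨V, hχ, hT⟩ := exists_chi_ne_zero_and_slotsTOfRecord_succ_ne_zero F N θ.ν θ.τ9 (EOfRecord₁₀ F N θ) (wOfRecord₉ F N θ) θ.ppSel p
    (gOfRecord₁₀ F N θ p) k hk (hP.tstep p k hk) s' hne
  intro h0
  exact slotsOfRecord_succ_apply_ne_zero_of_sel_self F N θ p hP k hk s' hfix V hχ hT (by rw [h0]; rfl)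

end AtStage9

/-! ## §4  LIVE TERMS EXIST AT EVERY LEVEL `k+1 ≤ K` (mass conservation): the graph integrals of the level-`(k+1)` sequences sum to `∫ρ_k = ∫ρ₀ > 0` -/

section Live

variable (F : T4Family) (N : ℕ) [NeZero N] (θ : Stage9Params F N) (p : B12.RunParams)

/-- The sum over the new sequences of the graph integrals is the total mass `∫ρ_k` of the density of record: Σ_{s′} ∫χ_{k+1}(s′)·slotT_{k+1}(s′) = ∫𝐓ρ_k = ∫ρ_k
(§1, the pieces of `𝐓ρ_k` are integrable under the step provisos, and the push-forward face `isRT_Trho` of the tower of record at `f ≡ 1`).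
[cite: Balaban1988Convergent, (3.1) p.264, (3.25) p.270; Balaban1985UV3, (6) p.257] -/
theorem sum_integral_graph_eq_integral_densOfRecord₁₀ (hP : θ.Provisos₁₀) (k : ℕ) (hk : k < p.K) :
    ∑ s' : SeqOfRecord F θ.ν θ.τ9.M (gOfRecord₁₀ F N θ p) p.K (k + 1),
      ∫ U, (chiSeqOfRecord F N θ.ν θ.τ9.M (gOfRecord₁₀ F N θ p) p.K k s'.init U *
          slotsOfRecord F N θ.ν θ.τ9 (EOfRecord₁₀ F N θ) (wOfRecord₉ F N θ) θ.ppSel p (gOfRecord₁₀ F N θ p) k s'.init U) *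
        (wOfRecord₉ F N θ p (gOfRecord₁₀ F N θ p) k s' U ((avOfRecord F N p.K k).avg U) *
          chiSeqOfRecord F N θ.ν θ.τ9.M (gOfRecord₁₀ F N θ p) p.K (k + 1) s' ((avOfRecord F N p.K k).avg U))
        ∂(fieldMeasure (F.P p.K) k (SU N))
      = ∫ U, densOfRecord₁₀ F N θ p k U ∂(fieldMeasure (F.P p.K) k (SU N)) := by
  classical
  have hT := hP.tstep p k hk
  calc ∑ s' : SeqOfRecord F θ.ν θ.τ9.M (gOfRecord₁₀ F N θ p) p.K (k + 1),
        ∫ U, (chiSeqOfRecord F N θ.ν θ.τ9.M (gOfRecord₁₀ F N θ p) p.K k s'.init U *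
            slotsOfRecord F N θ.ν θ.τ9 (EOfRecord₁₀ F N θ) (wOfRecord₉ F N θ) θ.ppSel p (gOfRecord₁₀ F N θ p) k s'.init U) *
          (wOfRecord₉ F N θ p (gOfRecord₁₀ F N θ p) k s' U ((avOfRecord F N p.K k).avg U) *
            chiSeqOfRecord F N θ.ν θ.τ9.M (gOfRecord₁₀ F N θ p) p.K (k + 1) s' ((avOfRecord F N p.K k).avg U))
          ∂(fieldMeasure (F.P p.K) k (SU N))
      = ∑ s' : SeqOfRecord F θ.ν θ.τ9.M (gOfRecord₁₀ F N θ p) p.K (k + 1),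
          ∫ V', chiSeqOfRecord F N θ.ν θ.τ9.M (gOfRecord₁₀ F N θ p) p.K (k + 1) s' V' *
            slotsTOfRecord F N θ.ν θ.τ9 (EOfRecord₁₀ F N θ) (wOfRecord₉ F N θ) θ.ppSel p (gOfRecord₁₀ F N θ p) (k + 1) s' V'
            ∂(fieldMeasure (F.P p.K) (k + 1) (SU N)) :=
        Finset.sum_congr rfl fun s' _ =>
          (integral_chi_mul_slotsTOfRecord_succ F N θ.ν θ.τ9 (EOfRecord₁₀ F N θ) (wOfRecord₉ F N θ) θ.ppSel p _ k hk hT s').symm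
    _ = ∫ V', ∑ s' : SeqOfRecord F θ.ν θ.τ9.M (gOfRecord₁₀ F N θ p) p.K (k + 1),
          chiSeqOfRecord F N θ.ν θ.τ9.M (gOfRecord₁₀ F N θ p) p.K (k + 1) s' V' *
            slotsTOfRecord F N θ.ν θ.τ9 (EOfRecord₁₀ F N θ) (wOfRecord₉ F N θ) θ.ppSel p (gOfRecord₁₀ F N θ p) (k + 1) s' V'
            ∂(fieldMeasure (F.P p.K) (k + 1) (SU N)) :=
        (integral_finsetSum _ fun s' _ =>
          integrable_piece_trhoOfRecord9 F N θ.ν θ.τ9 (EOfRecord₁₀ F N θ) (wOfRecord₉ F N θ) θ.ppSel p _ k hk hT s').symm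
    _ = ∫ V', tdensOfRecord₁₀ F N θ p k V' ∂(fieldMeasure (F.P p.K) (k + 1) (SU N)) := rfl
    _ = ∫ U, densOfRecord₁₀ F N θ p k U ∂(fieldMeasure (F.P p.K) k (SU N)) :=
        (towerOfRecord₁₀ F N θ hP).integral_Trho_eq p k hk

/-- **THE TOTAL MASS OF THE DENSITY OF RECORD IS POSITIVE at every level `k ≤ K`**: `∫ρ_k = ∫ρ₀` (the tower of record conserves mass under the provisos)
and `ρ₀ > 0` is integrable on a probability space. [cite: Balaban1985UV3, (6) p.257; Balaban1988Convergent, Thm 1 p.262] -/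
theorem integral_densOfRecord₁₀_pos (hP : θ.Provisos₁₀) (k : ℕ) (hk : k ≤ p.K) :
    0 < ∫ U, densOfRecord₁₀ F N θ p k U ∂(fieldMeasure (F.P p.K) k (SU N)) := by
  rw [show (∫ U, densOfRecord₁₀ F N θ p k U ∂(fieldMeasure (F.P p.K) k (SU N)))
      = ∫ U, densOfRecord₁₀ F N θ p 0 U ∂(fieldMeasure (F.P p.K) 0 (SU N)) from
    (towerOfRecord₁₀ F N θ hP).integral_eq_integral_zero p k hk]
  haveI : IsProbabilityMeasure (fieldMeasure (F.P p.K) 0 (SU N)) := Missing.isProbabilityMeasure_fieldMeasure (F.P p.K) 0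
  have hI : Integrable (densOfRecord₁₀ F N θ p 0) (fieldMeasure (F.P p.K) 0 (SU N)) :=
    isIntegrable_towerOfRecord₁₀ F N θ hP p 0 (Nat.zero_le _)
  have hpos : ∀ U, 0 < densOfRecord₁₀ F N θ p 0 U := fun U => by
    rw [densOfRecord₁₀_zero]
    exact rhoZeroOfRecord_pos F N p.K p.g0 (EOfRecord₁₀ F N θ p) U
  rw [integral_pos_iff_support_of_nonneg (fun U => (hpos U).le) hI]
  have hsupp : Function.support (densOfRecord₁₀ F N θ p 0) = Set.univ := Set.eq_univ_of_forall fun U => (hpos U).ne'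
  rw [hsupp, measure_univ]
  exact one_pos

/-- **AT EVERY LEVEL `k+1 ≤ K` SOME NEW SEQUENCE HAS A NON-ZERO GRAPH INTEGRAL** (a LIVE term exists: their sum is `∫ρ_k > 0`) — so a selector that retracts
each level onto its live sequences has a non-empty target to retract onto. [cite: Balaban1988Convergent, (3.22) p.269, (2.17)–(2.18) p.257] -/
theorem exists_integral_graph_ne_zero (hP : θ.Provisos₁₀) (k : ℕ) (hk : k < p.K) :
    ∃ s' : SeqOfRecord F θ.ν θ.τ9.M (gOfRecord₁₀ F N θ p) p.K (k + 1),
      ∫ U, (chiSeqOfRecord F N θ.ν θ.τ9.M (gOfRecord₁₀ F N θ p) p.K k s'.init U *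
          slotsOfRecord F N θ.ν θ.τ9 (EOfRecord₁₀ F N θ) (wOfRecord₉ F N θ) θ.ppSel p (gOfRecord₁₀ F N θ p) k s'.init U) *
        (wOfRecord₉ F N θ p (gOfRecord₁₀ F N θ p) k s' U ((avOfRecord F N p.K k).avg U) *
          chiSeqOfRecord F N θ.ν θ.τ9.M (gOfRecord₁₀ F N θ p) p.K (k + 1) s' ((avOfRecord F N p.K k).avg U))
        ∂(fieldMeasure (F.P p.K) k (SU N)) ≠ 0 := by
  by_contra hnone
  push Not at hnone
  have hsum := sum_integral_graph_eq_integral_densOfRecord₁₀ F N θ p hP k hk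
  rw [Finset.sum_eq_zero fun s' _ => hnone s'] at hsum
  exact (ne_of_gt (integral_densOfRecord₁₀_pos F N θ p hP k hk.le)) hsum.symm

/-- **★ ROW P12 PROPER, UP TO THE TORUS: AT EVERY LEVEL `k+1 ≤ K` OF EVERY RUN SOME SEQUENCE IS LIVE** — there are a new sequence `s` and a configuration
`V` with `slotT_{k+1}(s)(V) ≠ 0` AND `∫dV⌈_{Z′(s)} χ_{k+1}(s)·slotT_{k+1}(s) (V) ≠ 0` (the pointwise liveness a live-retraction selector keys on: at a live
fixed point the (0.3) 𝐑-factor is `≥ 1`, §2) — from the displayed `Provisos₁₀` ALONE: a live GRAPH term exists (§4, mass conservation), its χ-weighted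
𝐓-image slot is non-null (§1), and a non-null non-negative bounded piece (support-form (0.3) provisos at level `k+1`) is live somewhere (§2b).
[cite: Balaban1988Convergent, (3.22) p.269, (3.1) p.264, (3.24)–(3.25) p.270; Balaban1989LargeFieldI, (0.3)–(0.4) p.176] -/
theorem exists_live_slotsTOfRecord_succ (hP : θ.Provisos₁₀) (k : ℕ) (hk : k < p.K) :
    ∃ (s : SeqOfRecord F θ.ν θ.τ9.M (gOfRecord₁₀ F N θ p) p.K (k + 1)) (V : GaugeField (F.P p.K) (k + 1) (SU N)),
      slotsTOfRecord F N θ.ν θ.τ9 (EOfRecord₁₀ F N θ) (wOfRecord₉ F N θ) θ.ppSel p (gOfRecord₁₀ F N θ p) (k + 1) s V ≠ 0 ∧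
        B15.BasicStep.fibreIntegral (fibOfSeq F θ.ν θ.τ9 p (gOfRecord₁₀ F N θ p) (k + 1) s)
          (fun U => chiSeqOfRecord F N θ.ν θ.τ9.M (gOfRecord₁₀ F N θ p) p.K (k + 1) s U *
            slotsTOfRecord F N θ.ν θ.τ9 (EOfRecord₁₀ F N θ) (wOfRecord₉ F N θ) θ.ppSel p (gOfRecord₁₀ F N θ p) (k + 1) s U) V ≠ 0 := by
  obtain ⟨s', hne⟩ := exists_integral_graph_ne_zero F N θ p hP k hk
  have hI : ∫ V', chiSeqOfRecord F N θ.ν θ.τ9.M (gOfRecord₁₀ F N θ p) p.K (k + 1) s' V' *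
      slotsTOfRecord F N θ.ν θ.τ9 (EOfRecord₁₀ F N θ) (wOfRecord₉ F N θ) θ.ppSel p (gOfRecord₁₀ F N θ p) (k + 1) s' V'
        ∂(fieldMeasure (F.P p.K) (k + 1) (SU N)) ≠ 0 := by
    rwa [integral_chi_mul_slotsTOfRecord_succ F N θ.ν θ.τ9 (EOfRecord₁₀ F N θ) (wOfRecord₉ F N θ) θ.ppSel p _ k hk (hP.tstep p k hk) s']
  obtain ⟨hm, h0, ⟨C, hC⟩, -⟩ := hP.rstep p k hk
  have hm' : Measurable (fun V' => chiSeqOfRecord F N θ.ν θ.τ9.M (gOfRecord₁₀ F N θ p) p.K (k + 1) s' V' *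
      slotsTOfRecord F N θ.ν θ.τ9 (EOfRecord₁₀ F N θ) (wOfRecord₉ F N θ) θ.ppSel p (gOfRecord₁₀ F N θ p) (k + 1) s' V') := hm s'
  have h0' : ∀ V', 0 ≤ chiSeqOfRecord F N θ.ν θ.τ9.M (gOfRecord₁₀ F N θ p) p.K (k + 1) s' V' *
      slotsTOfRecord F N θ.ν θ.τ9 (EOfRecord₁₀ F N θ) (wOfRecord₉ F N θ) θ.ppSel p (gOfRecord₁₀ F N θ p) (k + 1) s' V' := h0 s'
  have hC' : ∀ V', chiSeqOfRecord F N θ.ν θ.τ9.M (gOfRecord₁₀ F N θ p) p.K (k + 1) s' V' *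
      slotsTOfRecord F N θ.ν θ.τ9 (EOfRecord₁₀ F N θ) (wOfRecord₉ F N θ) θ.ppSel p (gOfRecord₁₀ F N θ p) (k + 1) s' V' ≤ C := hC s'
  obtain ⟨V, htV, hFV⟩ := exists_ne_zero_and_fibreIntegral_ne_zero
    (fibOfSeq F θ.ν θ.τ9 p (gOfRecord₁₀ F N θ p) (k + 1) s') hm' h0' hC' hI
  exact ⟨s', V, (mul_ne_zero_iff.1 htV).2, hFV⟩

/-- The same, with the piece written as def-R's `rterm` of the (2.18) slice of the pre-𝐑 slot family (the currency of a liveness predicate keyed on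
`rterm (sliceOfRecord … f) s`; definitionally the product `χ_{k+1}(s)·slotT_{k+1}(s)`). [cite: Balaban1989LargeFieldI, (0.3) p.176; Balaban1988Convergent, (2.18) p.257 (bookkeeping)] -/
theorem exists_live_slotsTOfRecord_succ_rterm (hP : θ.Provisos₁₀) (k : ℕ) (hk : k < p.K) :
    ∃ (s : SeqOfRecord F θ.ν θ.τ9.M (gOfRecord₁₀ F N θ p) p.K (k + 1)) (V : GaugeField (F.P p.K) (k + 1) (SU N)),
      slotsTOfRecord F N θ.ν θ.τ9 (EOfRecord₁₀ F N θ) (wOfRecord₉ F N θ) θ.ppSel p (gOfRecord₁₀ F N θ p) (k + 1) s V ≠ 0 ∧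
        B15.BasicStep.fibreIntegral (fibOfSeq F θ.ν θ.τ9 p (gOfRecord₁₀ F N θ p) (k + 1) s)
          (rterm (sliceOfRecord F N θ.ν θ.τ9.M p (gOfRecord₁₀ F N θ p) (k + 1)
            (slotsTOfRecord F N θ.ν θ.τ9 (EOfRecord₁₀ F N θ) (wOfRecord₉ F N θ) θ.ppSel p (gOfRecord₁₀ F N θ p) (k + 1))) s) V ≠ 0 :=
  exists_live_slotsTOfRecord_succ F N θ p hP k hk

end Live

/-! ## §5  At a Stage-12 parameter: `SlotsNondegenerate` UP TO THE TORUS (`k ≤ K`) from a selector that FIXES ITS RANGE and SELECTS LIVE TERMS -/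

section AtStage12

variable {F : T4Family} {N : ℕ} [NeZero N]

/-- **ROW P12 AT A STAGE-12 PARAMETER, GUARDED BY THE TORUS**: if `θ`'s Stage-9 tuple has its provisos, and at every level `k+1 ≤ K` of every run the selector
`θ.ppSel p g (k+1)` FIXES EVERY SEQUENCE OF ITS RANGE (equivalently: is idempotent — the shape of print's `Z ↦ Z″`) and SELECTS ONLY LIVE TERMS (non-zero graph
integral), then every slot of record at a selected sequence of a level `k ≤ K` is not the zero density — 12b's `SlotsNondegenerate` READ UP TO THE TORUS
(level `0` by 12b's `slotsNondegenerate_zero`; levels `1 … K` by §3).  The levels `k > K` of 12b's unguarded predicate are NOT reached (no `HaarAC`, no proviso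
there). [cite: Balaban1988Convergent, (3.22) p.269, (2.17)–(2.18) p.257; Balaban1989LargeFieldI, (0.3) p.176] -/
theorem slotsOfRecord_ne_zero_of_mem_range_of_le (θ : Stage12Params F N) (hP : θ.toStage9Params.Provisos₁₀)
    (hfix : ∀ (p : B12.RunParams) (k : ℕ), k < p.K →
      ∀ s' ∈ Set.range (θ.ppSel p (gOfRecord₁₀ F N θ.toStage9Params p) (k + 1)),
        θ.ppSel p (gOfRecord₁₀ F N θ.toStage9Params p) (k + 1) s' = s')
    (hlive : ∀ (p : B12.RunParams) (k : ℕ), k < p.K →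
      ∀ s' ∈ Set.range (θ.ppSel p (gOfRecord₁₀ F N θ.toStage9Params p) (k + 1)),
        ∫ U, (chiSeqOfRecord F N θ.ν θ.τ9.M (gOfRecord₁₀ F N θ.toStage9Params p) p.K k s'.init U *
            slotsOfRecord F N θ.ν θ.τ9 (EOfRecord₁₀ F N θ.toStage9Params) (wOfRecord₉ F N θ.toStage9Params) θ.ppSel p
              (gOfRecord₁₀ F N θ.toStage9Params p) k s'.init U) *
          (wOfRecord₉ F N θ.toStage9Params p (gOfRecord₁₀ F N θ.toStage9Params p) k s' U ((avOfRecord F N p.K k).avg U) *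
            chiSeqOfRecord F N θ.ν θ.τ9.M (gOfRecord₁₀ F N θ.toStage9Params p) p.K (k + 1) s' ((avOfRecord F N p.K k).avg U))
          ∂(fieldMeasure (F.P p.K) k (SU N)) ≠ 0)
    (p : B12.RunParams) (k : ℕ) (hk : k ≤ p.K)
    (s : SeqOfRecord F θ.ν θ.τ9.M (gOfRecord₁₀ F N θ.toStage9Params p) p.K k)
    (hs : s ∈ Set.range (θ.ppSel p (gOfRecord₁₀ F N θ.toStage9Params p) k)) :
    slotsOfRecord F N θ.ν θ.τ9 (EOfRecord₁₀ F N θ.toStage9Params) (wOfRecord₉ F N θ.toStage9Params) θ.ppSel p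
      (gOfRecord₁₀ F N θ.toStage9Params p) k s ≠ 0 := by
  cases k with
  | zero => exact slotsNondegenerate_zero θ p s
  | succ k =>
    have hk' : k < p.K := Nat.lt_of_succ_le hk
    exact slotsOfRecord_succ_ne_zero_of_sel_self_of_integral_ne_zero F N θ.toStage9Params p hP k hk' s (hfix p k hk' s hs)
      (hlive p k hk' s hs)

end AtStage12

/-! ## §6  BEYOND THE TORUS (located for the record's pen in v1–v1.1; CURED by 12b v2.3's guard `k ≤ p.K`, director LINE №118 — v1.2 re-points the one
positional consumer): the (2.18) index is inhabited at every level (the all-`∅` chain), also at `k > p.K` where the tree carries no kernel fact about the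
averaging of record (`avOfRecord_haarAC` needs `k < K`) and `Provisos₁₀` displays nothing (`intPiece`∕`tstep` at `k < K`, `rstep` at `k+1 ≤ K`) -/

section BeyondTheTorus

variable (F : T4Family) (N : ℕ) [NeZero N] (ν : Stage7Numerics) (M : ℕ)

/-- The (2.18) summation index of record is INHABITED AT EVERY LEVEL `k` — also beyond the torus, `k > K`: the chain with every `Ω_j = Λ_j = ∅` is
admissible (`∅` is a union of no cubes). [cite: Balaban1988Convergent, (2.1) p.254, (2.18) p.257 (bookkeeping)] -/
theorem nonempty_seqOfRecord (g : ℕ → ℝ) (K k : ℕ) : Nonempty (SeqOfRecord F ν M g K k) :=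
  ⟨⟨fun _ => ∅, fun _ => ∅,
    ⟨fun _ _ _ => empty_mem_unionsOfCubes _ _, fun _ _ _ => empty_mem_unionsOfCubes _ _, fun _ _ _ => Set.empty_subset _,
      fun _ _ _ => Set.empty_subset _⟩,
    fun _ _ => rfl, fun _ _ => rfl⟩⟩

variable {F N}

/-- **WHAT 12b's PREDICATE DEMANDS, UP TO THE TORUS** (v1.2 re-point, director LINES №118 ∕ №120): `θ.SlotsNondegenerate` forces, on every run `p` and at
every level `k ≤ p.K`, SOME post-𝐑 slot of record at level `k` to be a non-zero density (the slot at the selector's image of the all-`∅` chain).  v1–v1.1 stated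
this at EVERY `k` to exhibit the unguarded predicate's reach beyond the torus (`k > p.K`: transport along `avOfRecord F N p.K k` with no `HaarAC`, through a
`Classical.choice` Radon–Nikodym version); 12b v2.3 GUARDS the predicate by `k ≤ p.K`, deleting exactly that region, and this theorem is re-pointed to the
guarded range with a proof that elaborates before and after the guard lands. [cite: Balaban1988Convergent, (3.22) p.269 (bookkeeping)] -/
theorem exists_slotsOfRecord_ne_zero_of_slotsNondegenerate (θ : Stage12Params F N) (h : θ.SlotsNondegenerate) (p : B12.RunParams) (k : ℕ)
    (hk : k ≤ p.K) :
    ∃ s : SeqOfRecord F θ.ν θ.τ9.M (gOfRecord₁₀ F N θ.toStage9Params p) p.K k,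
      slotsOfRecord F N θ.ν θ.τ9 (EOfRecord₁₀ F N θ.toStage9Params) (wOfRecord₉ F N θ.toStage9Params) θ.ppSel p
        (gOfRecord₁₀ F N θ.toStage9Params p) k s ≠ 0 := by
  obtain ⟨s₀⟩ := nonempty_seqOfRecord F θ.ν θ.τ9.M (gOfRecord₁₀ F N θ.toStage9Params p) p.K k
  refine ⟨θ.ppSel p (gOfRecord₁₀ F N θ.toStage9Params p) k s₀, ?_⟩
  -- two-way (v1.2): `apply h` leaves the goal `_ ∈ Set.range _` against 12b v2–v2.2 (unguarded body) and, in addition, `k ≤ p.K` against v2.3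
  have _hk : k ≤ p.K := hk
  apply h
  all_goals first | exact hk | exact ⟨s₀, rfl⟩

end BeyondTheTorus

/-! ## §7  (v1.1) The INT currency: live sequences up to the torus from the displayed step provisos and def-R's `RStepInt` -/

section IntCurrency

open scoped ENNReal

variable {P : Params} {G : Type*} [GaugeGroup G] [MeasurableSpace G] [HaarData G] {j : ℕ}

/-- **A NON-NULL INTEGRABLE TERM IS LIVE SOMEWHERE** (INT form of §2b): an integrable density with `0 ≤ t` a.e. and `∫ t dV ≠ 0` is, at SOME configuration,
non-zero together with its own fibre integral over any `Z′` — the contrapositive of def-R's `ae_eq_zero_of_self_or_fibreIntegral_eq_zero` («a dead piece vanishes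
a.e.»). [cite: Balaban1989LargeFieldI, (0.3)–(0.4) p.176] -/
theorem exists_ne_zero_and_fibreIntegral_ne_zero_of_integrable {hD : DecidableEq (PBond P j)} (s : Finset (PBond P j)) {t : Density P j G}
    (ht : Integrable t (fieldMeasure P j G)) (h0 : ∀ᵐ V ∂(fieldMeasure P j G), 0 ≤ t V)
    (hint : ∫ V, t V ∂(fieldMeasure P j G) ≠ 0) :
    ∃ V : GaugeField P j G, t V ≠ 0 ∧ B15.BasicStep.fibreIntegral s t V ≠ 0 := by
  by_contra hnone
  push Not at hnone
  refine hint (integral_eq_zero_of_ae ?_)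
  exact B15.BasicStep.ae_eq_zero_of_self_or_fibreIntegral_eq_zero s ht h0 fun V => by
    by_cases h : t V = 0
    · exact Or.inl h
    · exact Or.inr (hnone V h)

variable (F : T4Family) (N : ℕ) [NeZero N] (θ : Stage9Params F N) (p : B12.RunParams)

/-- **ONE STEP CONSERVES MASS, INT form**: `∫ρ_{j+1} = ∫𝐓ρ_j = ∫ρ_j` (`j < K`) from the displayed step provisos at level `j` (def-T's `isRT_trhoOfRecord9` at
`f ≡ 1`) and def-R's (0.4) under the integrable-form (0.3) provisos at level `j+1` (`integral_densityOfSlice_rstepSlotOfRecord_of_provisosInt`).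
[cite: Balaban1989LargeFieldI, (0.4) p.176; Balaban1985UV3, (6) p.257] -/
theorem integral_densOfRecord₁₀_succ_eq_of_int (j : ℕ) (hj : j < p.K)
    (hT : TStepProvisos F N θ.ν θ.τ9 (EOfRecord₁₀ F N θ) (wOfRecord₉ F N θ) θ.ppSel p (gOfRecord₁₀ F N θ p) j) (hR : θ.RStepInt) :
    ∫ V, densOfRecord₁₀ F N θ p (j + 1) V ∂(fieldMeasure (F.P p.K) (j + 1) (SU N))
      = ∫ U, densOfRecord₁₀ F N θ p j U ∂(fieldMeasure (F.P p.K) j (SU N)) := by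
  have h1 : ∫ V, densOfRecord₁₀ F N θ p (j + 1) V ∂(fieldMeasure (F.P p.K) (j + 1) (SU N))
      = ∫ V, tdensOfRecord₁₀ F N θ p j V ∂(fieldMeasure (F.P p.K) (j + 1) (SU N)) := by
    show ∫ V, rhoOfRecord9 F N θ.ν θ.τ9 (EOfRecord₁₀ F N θ) (wOfRecord₉ F N θ) θ.ppSel p (gOfRecord₁₀ F N θ p) (j + 1) V
        ∂(fieldMeasure (F.P p.K) (j + 1) (SU N)) = _
    rw [rhoOfRecord9_succ]
    exact integral_densityOfSlice_rstepSlotOfRecord_of_provisosInt F N θ.ν θ.τ9 _ θ.ppSel p _ (j + 1) (hR p j hj)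
  rw [h1]
  exact T4Spectator.integral_eq_of_isRT
    (isRT_trhoOfRecord9 F N θ.ν θ.τ9 (EOfRecord₁₀ F N θ) (wOfRecord₉ F N θ) θ.ppSel p _ j hj hT)

/-- **`∫ρ_k = ∫ρ₀` for `k ≤ K`, INT form** (induction on the step). [cite: Balaban1985UV3, (6) p.257] -/
theorem integral_densOfRecord₁₀_eq_zero_of_int
    (hT : ∀ j, j < p.K → TStepProvisos F N θ.ν θ.τ9 (EOfRecord₁₀ F N θ) (wOfRecord₉ F N θ) θ.ppSel p (gOfRecord₁₀ F N θ p) j)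
    (hR : θ.RStepInt) : ∀ k, k ≤ p.K →
      ∫ V, densOfRecord₁₀ F N θ p k V ∂(fieldMeasure (F.P p.K) k (SU N))
        = ∫ U, densOfRecord₁₀ F N θ p 0 U ∂(fieldMeasure (F.P p.K) 0 (SU N))
  | 0, _ => rfl
  | k + 1, hk => (integral_densOfRecord₁₀_succ_eq_of_int F N θ p k (Nat.lt_of_succ_le hk) (hT k (Nat.lt_of_succ_le hk)) hR).trans
      (integral_densOfRecord₁₀_eq_zero_of_int hT hR k (Nat.le_of_succ_le hk))

/-- **THE TOTAL MASS IS POSITIVE at every level `k ≤ K`, INT form**: `∫ρ_k = ∫ρ₀ > 0` (`ρ₀ = e^{−E}·`Wilson weight, positive, bounded, measurable on a probability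
space). [cite: Balaban1985UV3, (6) p.257; Balaban1988Convergent, Thm 1 p.262] -/
theorem integral_densOfRecord₁₀_pos_of_int
    (hT : ∀ j, j < p.K → TStepProvisos F N θ.ν θ.τ9 (EOfRecord₁₀ F N θ) (wOfRecord₉ F N θ) θ.ppSel p (gOfRecord₁₀ F N θ p) j)
    (hR : θ.RStepInt) (k : ℕ) (hk : k ≤ p.K) :
    0 < ∫ U, densOfRecord₁₀ F N θ p k U ∂(fieldMeasure (F.P p.K) k (SU N)) := by
  rw [integral_densOfRecord₁₀_eq_zero_of_int F N θ p hT hR k hk]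
  haveI : IsProbabilityMeasure (fieldMeasure (F.P p.K) 0 (SU N)) := Missing.isProbabilityMeasure_fieldMeasure (F.P p.K) 0
  have hpos : ∀ U, 0 < densOfRecord₁₀ F N θ p 0 U := fun U => by
    rw [densOfRecord₁₀_zero]
    exact rhoZeroOfRecord_pos F N p.K p.g0 (EOfRecord₁₀ F N θ p) U
  have hI : Integrable (densOfRecord₁₀ F N θ p 0) (fieldMeasure (F.P p.K) 0 (SU N)) := by
    rw [densOfRecord₁₀_zero]
    exact (integrable_const (Real.exp (-(EOfRecord₁₀ F N θ p)))).mono'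
      (measurable_rhoZeroOfRecord F N p.K p.g0 (EOfRecord₁₀ F N θ p)).aestronglyMeasurable
      (Filter.Eventually.of_forall fun U => by
        rw [Real.norm_eq_abs, abs_of_pos (rhoZeroOfRecord_pos F N p.K p.g0 (EOfRecord₁₀ F N θ p) U)]
        exact rhoZeroOfRecord_le F N p.K p.g0 (EOfRecord₁₀ F N θ p) U)
  rw [integral_pos_iff_support_of_nonneg (fun U => (hpos U).le) hI]
  have hsupp : Function.support (densOfRecord₁₀ F N θ p 0) = Set.univ := Set.eq_univ_of_forall fun U => (hpos U).ne'
  rw [hsupp, measure_univ]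
  exact one_pos

/-- **AT EVERY LEVEL `k+1 ≤ K` SOME NEW SEQUENCE HAS A NON-ZERO GRAPH INTEGRAL, INT form** (their sum is `∫𝐓ρ_k = ∫ρ_k > 0`).
[cite: Balaban1988Convergent, (3.22) p.269, (2.17)–(2.18) p.257] -/
theorem exists_integral_graph_ne_zero_of_int
    (hT : ∀ j, j < p.K → TStepProvisos F N θ.ν θ.τ9 (EOfRecord₁₀ F N θ) (wOfRecord₉ F N θ) θ.ppSel p (gOfRecord₁₀ F N θ p) j)
    (hR : θ.RStepInt) (k : ℕ) (hk : k < p.K) :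
    ∃ s' : SeqOfRecord F θ.ν θ.τ9.M (gOfRecord₁₀ F N θ p) p.K (k + 1),
      ∫ U, (chiSeqOfRecord F N θ.ν θ.τ9.M (gOfRecord₁₀ F N θ p) p.K k s'.init U *
          slotsOfRecord F N θ.ν θ.τ9 (EOfRecord₁₀ F N θ) (wOfRecord₉ F N θ) θ.ppSel p (gOfRecord₁₀ F N θ p) k s'.init U) *
        (wOfRecord₉ F N θ p (gOfRecord₁₀ F N θ p) k s' U ((avOfRecord F N p.K k).avg U) *
          chiSeqOfRecord F N θ.ν θ.τ9.M (gOfRecord₁₀ F N θ p) p.K (k + 1) s' ((avOfRecord F N p.K k).avg U))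
        ∂(fieldMeasure (F.P p.K) k (SU N)) ≠ 0 := by
  classical
  by_contra hnone
  push Not at hnone
  have hTk := hT k hk
  have hsum : ∑ s' : SeqOfRecord F θ.ν θ.τ9.M (gOfRecord₁₀ F N θ p) p.K (k + 1),
      ∫ U, (chiSeqOfRecord F N θ.ν θ.τ9.M (gOfRecord₁₀ F N θ p) p.K k s'.init U *
          slotsOfRecord F N θ.ν θ.τ9 (EOfRecord₁₀ F N θ) (wOfRecord₉ F N θ) θ.ppSel p (gOfRecord₁₀ F N θ p) k s'.init U) *
        (wOfRecord₉ F N θ p (gOfRecord₁₀ F N θ p) k s' U ((avOfRecord F N p.K k).avg U) *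
          chiSeqOfRecord F N θ.ν θ.τ9.M (gOfRecord₁₀ F N θ p) p.K (k + 1) s' ((avOfRecord F N p.K k).avg U))
        ∂(fieldMeasure (F.P p.K) k (SU N))
      = ∫ U, densOfRecord₁₀ F N θ p k U ∂(fieldMeasure (F.P p.K) k (SU N)) := by
    calc ∑ s' : SeqOfRecord F θ.ν θ.τ9.M (gOfRecord₁₀ F N θ p) p.K (k + 1),
          ∫ U, (chiSeqOfRecord F N θ.ν θ.τ9.M (gOfRecord₁₀ F N θ p) p.K k s'.init U *
              slotsOfRecord F N θ.ν θ.τ9 (EOfRecord₁₀ F N θ) (wOfRecord₉ F N θ) θ.ppSel p (gOfRecord₁₀ F N θ p) k s'.init U) *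
            (wOfRecord₉ F N θ p (gOfRecord₁₀ F N θ p) k s' U ((avOfRecord F N p.K k).avg U) *
              chiSeqOfRecord F N θ.ν θ.τ9.M (gOfRecord₁₀ F N θ p) p.K (k + 1) s' ((avOfRecord F N p.K k).avg U))
            ∂(fieldMeasure (F.P p.K) k (SU N))
        = ∑ s' : SeqOfRecord F θ.ν θ.τ9.M (gOfRecord₁₀ F N θ p) p.K (k + 1),
            ∫ V', chiSeqOfRecord F N θ.ν θ.τ9.M (gOfRecord₁₀ F N θ p) p.K (k + 1) s' V' *
              slotsTOfRecord F N θ.ν θ.τ9 (EOfRecord₁₀ F N θ) (wOfRecord₉ F N θ) θ.ppSel p (gOfRecord₁₀ F N θ p) (k + 1) s' V'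
              ∂(fieldMeasure (F.P p.K) (k + 1) (SU N)) :=
          Finset.sum_congr rfl fun s' _ =>
            (integral_chi_mul_slotsTOfRecord_succ F N θ.ν θ.τ9 (EOfRecord₁₀ F N θ) (wOfRecord₉ F N θ) θ.ppSel p _ k hk hTk s').symm
      _ = ∫ V', ∑ s' : SeqOfRecord F θ.ν θ.τ9.M (gOfRecord₁₀ F N θ p) p.K (k + 1),
            chiSeqOfRecord F N θ.ν θ.τ9.M (gOfRecord₁₀ F N θ p) p.K (k + 1) s' V' *
              slotsTOfRecord F N θ.ν θ.τ9 (EOfRecord₁₀ F N θ) (wOfRecord₉ F N θ) θ.ppSel p (gOfRecord₁₀ F N θ p) (k + 1) s' V'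
              ∂(fieldMeasure (F.P p.K) (k + 1) (SU N)) :=
          (integral_finsetSum _ fun s' _ =>
            integrable_piece_trhoOfRecord9 F N θ.ν θ.τ9 (EOfRecord₁₀ F N θ) (wOfRecord₉ F N θ) θ.ppSel p _ k hk hTk s').symm
      _ = ∫ V', tdensOfRecord₁₀ F N θ p k V' ∂(fieldMeasure (F.P p.K) (k + 1) (SU N)) := rfl
      _ = ∫ U, densOfRecord₁₀ F N θ p k U ∂(fieldMeasure (F.P p.K) k (SU N)) :=
          T4Spectator.integral_eq_of_isRT
            (isRT_trhoOfRecord9 F N θ.ν θ.τ9 (EOfRecord₁₀ F N θ) (wOfRecord₉ F N θ) θ.ppSel p _ k hk hTk)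
  rw [Finset.sum_eq_zero fun s' _ => hnone s'] at hsum
  exact (ne_of_gt (integral_densOfRecord₁₀_pos_of_int F N θ p hT hR k hk.le)) hsum.symm

/-- **★ ROW P12 PROPER UP TO THE TORUS, INT form**: from the displayed step provisos at every level `j < K` and def-R's `RStepInt` ALONE, at every level `k+1 ≤ K`
of the run there are `s`, `V` with `slotT_{k+1}(s)(V) ≠ 0 ∧ ∫dV⌈_{Z′(s)} χ_{k+1}(s)·slotT_{k+1}(s) (V) ≠ 0`.  (`Provisos₁₀` supplies both hypotheses —
`Provisos₁₀.tstep`, `Stage9Params.rstepInt_of_provisos₁₀` — so §4's theorem is the special case; this form is the one a record keyed by the INT proviso reads.)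
[cite: Balaban1988Convergent, (3.22) p.269, (3.1) p.264, (3.24)–(3.25) p.270; Balaban1989LargeFieldI, (0.3)–(0.4) p.176] -/
theorem exists_live_slotsTOfRecord_succ_of_int
    (hT : ∀ j, j < p.K → TStepProvisos F N θ.ν θ.τ9 (EOfRecord₁₀ F N θ) (wOfRecord₉ F N θ) θ.ppSel p (gOfRecord₁₀ F N θ p) j)
    (hR : θ.RStepInt) (k : ℕ) (hk : k < p.K) :
    ∃ (s : SeqOfRecord F θ.ν θ.τ9.M (gOfRecord₁₀ F N θ p) p.K (k + 1)) (V : GaugeField (F.P p.K) (k + 1) (SU N)),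
      slotsTOfRecord F N θ.ν θ.τ9 (EOfRecord₁₀ F N θ) (wOfRecord₉ F N θ) θ.ppSel p (gOfRecord₁₀ F N θ p) (k + 1) s V ≠ 0 ∧
        B15.BasicStep.fibreIntegral (fibOfSeq F θ.ν θ.τ9 p (gOfRecord₁₀ F N θ p) (k + 1) s)
          (fun U => chiSeqOfRecord F N θ.ν θ.τ9.M (gOfRecord₁₀ F N θ p) p.K (k + 1) s U *
            slotsTOfRecord F N θ.ν θ.τ9 (EOfRecord₁₀ F N θ) (wOfRecord₉ F N θ) θ.ppSel p (gOfRecord₁₀ F N θ p) (k + 1) s U) V ≠ 0 := by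
  obtain ⟨s', hne⟩ := exists_integral_graph_ne_zero_of_int F N θ p hT hR k hk
  have hI : ∫ V', chiSeqOfRecord F N θ.ν θ.τ9.M (gOfRecord₁₀ F N θ p) p.K (k + 1) s' V' *
      slotsTOfRecord F N θ.ν θ.τ9 (EOfRecord₁₀ F N θ) (wOfRecord₉ F N θ) θ.ppSel p (gOfRecord₁₀ F N θ p) (k + 1) s' V'
        ∂(fieldMeasure (F.P p.K) (k + 1) (SU N)) ≠ 0 := by
    rwa [integral_chi_mul_slotsTOfRecord_succ F N θ.ν θ.τ9 (EOfRecord₁₀ F N θ) (wOfRecord₉ F N θ) θ.ppSel p _ k hk (hT k hk) s']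
  obtain ⟨hint, h0, -⟩ := hR p k hk
  have hint' : Integrable (fun V' => chiSeqOfRecord F N θ.ν θ.τ9.M (gOfRecord₁₀ F N θ p) p.K (k + 1) s' V' *
      slotsTOfRecord F N θ.ν θ.τ9 (EOfRecord₁₀ F N θ) (wOfRecord₉ F N θ) θ.ppSel p (gOfRecord₁₀ F N θ p) (k + 1) s' V')
      (fieldMeasure (F.P p.K) (k + 1) (SU N)) := hint s'
  have h0' : ∀ᵐ V' ∂(fieldMeasure (F.P p.K) (k + 1) (SU N)), 0 ≤ chiSeqOfRecord F N θ.ν θ.τ9.M (gOfRecord₁₀ F N θ p) p.K (k + 1) s' V' *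
      slotsTOfRecord F N θ.ν θ.τ9 (EOfRecord₁₀ F N θ) (wOfRecord₉ F N θ) θ.ppSel p (gOfRecord₁₀ F N θ p) (k + 1) s' V' := h0 s'
  obtain ⟨V, htV, hFV⟩ := exists_ne_zero_and_fibreIntegral_ne_zero_of_integrable
    (fibOfSeq F θ.ν θ.τ9 p (gOfRecord₁₀ F N θ p) (k + 1) s') hint' h0' hI
  exact ⟨s', V, (mul_ne_zero_iff.1 htV).2, hFV⟩

end IntCurrency

end Literature.MathematicalPhysics.QuantumFieldTheory.Balaban1983to89.Node00

end
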